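import Literature.NumberTheory.DiophantineGeometry.AVIsogenyTateHomPoincareProofs
import HarnessLib

/-!
# Injectivity of the Tate map from Step I alone (Mumford §19, Thm. 3; Milne 1986, Thm. 12.5)

Third proof file for the named fact
`Literature.AlgebraicGeometry.Motives.AbelianVariety.faltingsTateMap_injective A B` of `AVIsogenyTate`
(for every prime `ℓ` invertible in `K`, `ℤ_ℓ ⊗_ℤ Hom(A, B) → Hom_{Γ_K}(T_ℓ A, T_ℓ B)` is injective;
Mumford, *Abelian Varieties*, §19, Theorem 3; Milne, *Abelian Varieties* (1986), Thm. 12.5), after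
`AVIsogenyTateInjectiveProofs` (Milne's Lemma 12.6 and the `ℓ`-adic criterion, reducing the fact to
`module_finite_hom A B`) and `AVIsogenyTateHomStepIIProofs` (Step II: injectivity on `ℤ_ℓ ⊗ M` for a
*saturated* finitely generated `M ≤ Hom(A, B)`).

The printed proof of Theorem 3 (Mumford pp. 176–178; Milne 1986, PDF pp. 190–192 of the held copy
of Cornell–Silverman) has three steps: (I) the saturation `ℚM ∩ Hom(A, B)` of a finitely generated
`M` is finitely generated (degree polynomial, Poincaré reducibility); (II) hence `T_ℓ` is injective
on `ℤ_ℓ ⊗ M` for such saturations (Lemma 12.6 and `ℓ`-adic approximation); (III) hence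
`rank Hom(A, B) ≤ 4 dim A dim B` and `Hom(A, B)` is finitely generated (structure of `T_ℓ`, i.e. the
torsion counts). The injectivity assertion of Theorem 3 needs **only (I) and (II)**: every element
of `ℤ_ℓ ⊗ Hom(A, B)` comes from `ℤ_ℓ ⊗ M` for some finitely generated `M`, hence from `ℤ_ℓ ⊗ S₀`
for the saturation `S₀ ⊇ M`, on which the Tate map is injective. This file records that deduction,
so that in the tree `faltingsTateMap_injective A B` no longer passes through `module_finite_hom A B`
(and thereby through the torsion counts `natCard_torsionPoints_of_isAlgClosed` of `A` and `B`, the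
theorem of the cube side of Step III), but rests on Step I alone — and in fact on its `ℓ`-primary
part:

* `AbelianVariety.faltingsTateMap_comp_baseChange_injective_of_pow_saturated` — Step II for an
  `ℓ`-saturated finitely generated `M` (`ℓᵏ f ∈ M ⇒ f ∈ M`; the printed argument uses saturation
  only at powers of `ℓ`);
* `AbelianVariety.faltingsTateMap_injective_of_exists_fg_pow_saturation` — **injectivity at `ℓ`
  from the `ℓ`-local Step I**: if the `ℓ`-saturation `{f | ℓᵏ f ∈ M}` of every finitely generated
  `M ≤ Hom(A, B)` lies in a finitely generated subgroup, `faltingsTateMap A B ℓ` is injective;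
* `AbelianVariety.faltingsTateMap_injective_of_exists_fg_saturation` — **the named fact
  `faltingsTateMap_injective A B` from Step I** for the pair `(A, B)` (saturations of finitely
  generated subgroups of `Hom(A, B)` lie in finitely generated subgroups; Milne 1986, Lemma 12.7,
  condition `(*)`);
* `AbelianVariety.faltingsTateMap_injective_end_of_degree` — for `X` all of whose non-zero
  endomorphisms are isogenies (e.g. `X` simple), `faltingsTateMap_injective X X` from the degree
  theorem for `End(X)` alone (Mumford §19, Thm. 2; Step I is then
  `exists_fg_saturation_end_of_degree` of `AVIsogenyTateHomStepIProofs`) — no Poincaré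
  reducibility, no torsion counts;
* `AbelianVariety.faltingsTateMap_injective_of_poincare_of_degree` (and `…_of_charZero`,
  `…_of_isIsogeny_zsmul_id`) — `faltingsTateMap_injective A B` for all `A`, `B` from the hypotheses
  of `exists_fg_saturation_hom_of_poincare` (`AVIsogenyTateHomPoincareProofs`): torsion-freeness of
  `Hom` (automatic in characteristic `0`, or from `isIsogeny_zsmul_id`), "non-zero homomorphisms
  between simple abelian varieties are isogenies" (§19 Cor. 2 of Thm. 1), the degree theorem for
  simple abelian varieties (§19 Thm. 2) and Poincaré's complete reducibility theorem (§19 Thm. 1) —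
  again without the torsion counts that `module_finite_hom_of_poincare_of_degree_of_natCard_torsionPoints`
  needs.

So the trust base of `faltingsTateMap_injective` displayed in the tree is now: Poincaré
reducibility, simplicity ⇒ isogeny, and the degree theorem (resp. the degree theorem alone for
`End(X)`, `X` simple).

## References

* [MumfordAV1970] D. Mumford, *Abelian Varieties*, §19, Theorem 3 and its proof (pp. 176–178 of
  the 2nd ed.). Not held; architecture as in Milne 1986.
* [Milne1986AbelianVarieties] J. S. Milne, *Abelian Varieties*, in Cornell–Silverman (eds.),
  *Arithmetic Geometry*, Springer 1986, §12, Thm. 12.5, Lemmas 12.6–12.7 (held: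
  `book:cornellnd-arithmetic-geometry`, PDF pp. 190–192).

## Design

No definitions, no named facts. The `ℓ`-saturation of `M` is built inside the proof as an
anonymous `Submodule ℤ (A ⟶ B)`; "an element of `ℤ_ℓ ⊗ Hom(A, B)` comes from `ℤ_ℓ ⊗ M` with `M`
finitely generated" is Mathlib's `TensorProduct.exists_finite_submodule_right_of_setFinite`, and no
flatness of `ℤ_ℓ` is needed (injectivity is tested on the composite `ℤ_ℓ ⊗ S₀ → Hom_{Γ_K}`).
Mathlib searched and used: `TensorProduct.exists_finite_submodule_right_of_setFinite`,
`LinearMap.baseChange_eq_ltensor`, `LinearMap.lTensor_comp`, `Submodule.FG.of_le_of_isNoetherian`.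
-/

universe u

open CategoryTheory CategoryTheory.Limits MvPolynomial

noncomputable section

namespace Literature.NumberTheory.DiophantineGeometry

section AbelianVariety
open Literature.AlgebraicGeometry.Motives (AbelianVariety)
open Literature.AlgebraicGeometry.Motives.AbelianVariety

open scoped TensorProduct

variable {K : Type u} [Field K] {A B : AbelianVariety K}

/-! ### Step II at powers of `ℓ` and the passage from Step I to injectivity -/

section Local

variable (ℓ : ℕ) [Fact ℓ.Prime]

/-- **Step II of the printed proof, `ℓ`-local form.** For a prime `ℓ` invertible in `K` and a
finitely generated `M ≤ Hom(A, B)` which is `ℓ`-saturated (`ℓᵏ f ∈ M ⇒ f ∈ M`), the Tate map is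
injective on `ℤ_ℓ ⊗ M`: if `T_ℓ ψ`, `ψ ∈ M`, is divisible by `ℓⁿ` in `Hom_{Γ_K}(T_ℓ A, T_ℓ B)` then
`ψ = ℓⁿ χ` in `Hom(A, B)` (Milne 1986, Lemma 12.6, `exists_eq_pow_smul_of_tateModuleMap_eq`), and
`χ ∈ M` by `ℓ`-saturation, which is the divisibility hypothesis of the `ℓ`-adic criterion
`PadicInt.injective_of_forall_exists_eq_pow_smul` (Milne 1986, proof of Thm. 12.5, last paragraph;
Mumford §19, proof of Thm. 3, second step). Same proof as
`faltingsTateMap_comp_baseChange_injective_of_saturated`, whose saturation hypothesis is only ever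
used at powers of `ℓ`. [cite: Milne1986AbelianVarieties, Thm. 12.5 (proof) and Lemma 12.7 (PDF pp. 191–192)] -/
theorem _root_.Literature.AlgebraicGeometry.Motives.AbelianVariety.faltingsTateMap_comp_baseChange_injective_of_pow_saturated
    (hℓ : (ℓ : K) ≠ 0) (M : Submodule ℤ (A ⟶ B)) (hM : M.FG)
    (hsat : ∀ (k : ℕ) (f : A ⟶ B), ((ℓ : ℤ) ^ k) • f ∈ M → f ∈ M) :
    Function.Injective ((faltingsTateMap A B ℓ).comp (M.subtype.baseChange ℤ_[ℓ])) := by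
  haveI : Module.Finite ℤ M := Module.Finite.iff_fg.2 hM
  refine PadicInt.injective_of_forall_exists_eq_pow_smul _ fun n ψ g h => ?_
  have h1 : homToTate A B ℓ (ψ : A ⟶ B) = ((ℓ : ℤ_[ℓ]) ^ n) • g := by
    rw [← faltingsTateMap_one_tmul]
    simpa only [LinearMap.comp_apply, LinearMap.baseChange_tmul, Submodule.subtype_apply] using h
  have h2 : tateModuleMap ℓ (ψ : A ⟶ B) = ((ℓ : ℤ_[ℓ]) ^ n) • g.toLinearMap := by
    rw [← toLinearMap_tateIntertwiningMap, ← homToTate_apply, h1,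
      Representation.IntertwiningMap.toLinearMap_smul]
  obtain ⟨χ, hχ⟩ := exists_eq_pow_smul_of_tateModuleMap_eq ℓ hℓ n (ψ : A ⟶ B) g.toLinearMap h2
  have hχM : χ ∈ M := hsat n χ (by rw [← hχ]; exact ψ.2)
  exact ⟨⟨χ, hχM⟩, Subtype.ext hχ⟩

variable (A B) in
/-- **Injectivity of the Tate map at `ℓ` from the `ℓ`-local Step I.** Let `ℓ` be a prime
invertible in `K` and suppose that for every finitely generated `M ≤ Hom(A, B)` the
`ℓ`-saturation `{f | ℓᵏ f ∈ M for some k}` lies in a finitely generated subgroup. Then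
`faltingsTateMap A B ℓ : ℤ_ℓ ⊗ Hom(A, B) → Hom_{Γ_K}(T_ℓ A, T_ℓ B)` is injective: an element `x` of
the kernel comes from `ℤ_ℓ ⊗ M` for a finitely generated `M`
(`TensorProduct.exists_finite_submodule_right_of_setFinite`), hence from `ℤ_ℓ ⊗ S₀` for the
`ℓ`-saturation `S₀ ⊇ M`, which is finitely generated (`ℤ` noetherian) and `ℓ`-saturated, and the
Tate map is injective on `ℤ_ℓ ⊗ S₀`
(`faltingsTateMap_comp_baseChange_injective_of_pow_saturated`), so `x = 0` (Milne 1986, proof of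
Thm. 12.5: "let `M` be the subgroup generated by the `eᵢ` … we may assume `M = M'`").
[cite: Milne1986AbelianVarieties, Thm. 12.5 (proof, PDF pp. 191–192)] -/
theorem _root_.Literature.AlgebraicGeometry.Motives.AbelianVariety.faltingsTateMap_injective_of_exists_fg_pow_saturation
    (hℓ : (ℓ : K) ≠ 0)
    (hsat : ∀ M : Submodule ℤ (A ⟶ B), M.FG →
      ∃ S : Submodule ℤ (A ⟶ B), S.FG ∧ ∀ f : A ⟶ B, (∃ k : ℕ, ((ℓ : ℤ) ^ k) • f ∈ M) → f ∈ S) :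
    Function.Injective (faltingsTateMap A B ℓ) := by
  rw [injective_iff_map_eq_zero]
  intro x hx
  obtain ⟨M, hMfin, hxM⟩ :=
    TensorProduct.exists_finite_submodule_right_of_setFinite ({x} : Set (ℤ_[ℓ] ⊗[ℤ] (A ⟶ B)))
      (Set.finite_singleton x)
  obtain ⟨S, hSfg, hS⟩ := hsat M (Module.Finite.iff_fg.1 hMfin)
  -- the `ℓ`-saturation `S₀` of `M` inside `Hom(A, B)`
  let S₀ : Submodule ℤ (A ⟶ B) :=
    { carrier := {f | ∃ k : ℕ, ((ℓ : ℤ) ^ k) • f ∈ M}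
      add_mem' := by
        rintro f g ⟨j, hj⟩ ⟨k, hk⟩
        refine ⟨j + k, ?_⟩
        rw [smul_add]
        refine M.add_mem ?_ ?_
        · rw [pow_add, mul_comm, mul_smul]
          exact M.smul_mem _ hj
        · rw [pow_add, mul_smul]
          exact M.smul_mem _ hk
      zero_mem' := ⟨0, by rw [smul_zero]; exact M.zero_mem⟩
      smul_mem' := by
        rintro c f ⟨k, hk⟩
        exact ⟨k, by rw [smul_comm]; exact M.smul_mem c hk⟩ }
  have hMS₀ : M ≤ S₀ := fun f hf => ⟨0, by rwa [pow_zero, one_smul]⟩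
  have hS₀S : S₀ ≤ S := fun f hf => hS f hf
  haveI : Module.Finite ℤ S := Module.Finite.iff_fg.2 hSfg
  have hS₀fg : S₀.FG := Submodule.FG.of_le_of_isNoetherian hS₀S
  have hS₀sat : ∀ (k : ℕ) (f : A ⟶ B), ((ℓ : ℤ) ^ k) • f ∈ S₀ → f ∈ S₀ := by
    rintro k f ⟨j, hj⟩
    exact ⟨k + j, by rwa [pow_add, mul_comm, mul_smul]⟩
  have hinj := faltingsTateMap_comp_baseChange_injective_of_pow_saturated ℓ hℓ S₀ hS₀fg hS₀sat
  obtain ⟨y, rfl⟩ : x ∈ LinearMap.range (M.subtype.lTensor ℤ_[ℓ]) := hxM (Set.mem_singleton x)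
  have hfac : M.subtype = S₀.subtype ∘ₗ Submodule.inclusion hMS₀ := rfl
  have hy : M.subtype.lTensor ℤ_[ℓ] y =
      (S₀.subtype.baseChange ℤ_[ℓ]) ((Submodule.inclusion hMS₀).lTensor ℤ_[ℓ] y) := by
    rw [hfac, LinearMap.lTensor_comp, LinearMap.comp_apply]
    exact (congrFun (LinearMap.baseChange_eq_ltensor (A := ℤ_[ℓ]) S₀.subtype) _).symm
  rw [hy] at hx ⊢
  have h0 : (Submodule.inclusion hMS₀).lTensor ℤ_[ℓ] y = 0 :=
    hinj (by rw [LinearMap.comp_apply, hx, map_zero])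
  rw [h0, map_zero]

end Local

variable (A B) in
/-- **The injectivity assertion of Mumford §19 Thm. 3 from Step I** (Milne 1986, Thm. 12.5 with
Lemma 12.7, condition `(*)`): if the saturation `{f | n f ∈ M, some n ≠ 0}` of every finitely
generated `M ≤ Hom(A, B)` lies in a finitely generated subgroup, then the named fact
`faltingsTateMap_injective A B` holds — for every prime `ℓ` invertible in `K` the Tate map
`ℤ_ℓ ⊗ Hom(A, B) → Hom_{Γ_K}(T_ℓ A, T_ℓ B)` is injective
(`faltingsTateMap_injective_of_exists_fg_pow_saturation`, the `ℓ`-saturation being contained in the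
saturation). Unlike `faltingsTateMap_injective_of_module_finite_hom` this does not go through the
finite generation of `Hom(A, B)` itself (Step III, which needs the torsion counts).
[cite: MumfordAV1970, §19 Thm. 3 (proof, first and second steps)] -/
theorem _root_.Literature.AlgebraicGeometry.Motives.AbelianVariety.faltingsTateMap_injective_of_exists_fg_saturation
    (hsat : ∀ M : Submodule ℤ (A ⟶ B), M.FG →
      ∃ S : Submodule ℤ (A ⟶ B), S.FG ∧ ∀ f : A ⟶ B, (∃ n : ℤ, n ≠ 0 ∧ n • f ∈ M) → f ∈ S) :
    faltingsTateMap_injective A B := by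
  intro ℓ _ hℓ
  refine faltingsTateMap_injective_of_exists_fg_pow_saturation A B ℓ hℓ fun M hM => ?_
  obtain ⟨S, hS, h⟩ := hsat M hM
  exact ⟨S, hS, fun f ⟨k, hk⟩ =>
    h f ⟨(ℓ : ℤ) ^ k, pow_ne_zero _ (Int.natCast_ne_zero.2 (Fact.out : ℓ.Prime).ne_zero), hk⟩⟩

/-! ### From the geometric inputs of Step I -/

open Classical in
/-- **`faltingsTateMap_injective X X` from the degree theorem, for `X` all of whose non-zero
endomorphisms are isogenies** (e.g. `X` simple; Milne 1986, Lemma 12.7: "every nonzero element of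
`End(A)` is an isogeny"): granted that the degree `φ ↦ deg φ` (`= ord Ker φ` on isogenies, `0`
otherwise) is, on integer combinations of every finite family of endomorphisms, a rational
polynomial with values homogeneous of degree `2 dim X` (Mumford §19, Thm. 2; Milne 1986,
Prop. 12.4), the Tate map `ℤ_ℓ ⊗ End(X) → End_{Γ_K}(T_ℓ X)` is injective for every prime `ℓ`
invertible in `K`. Step I is `exists_fg_saturation_end_of_degree` (`AVIsogenyTateHomStepIProofs`)
when `dim X > 0`; when `dim X = 0`, `End(X) = 0` (`hom_eq_zero_of_dim_eq_zero`). Neither Poincaré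
reducibility nor the torsion counts enter. [cite: Milne1986AbelianVarieties, Lemma 12.7 and Thm. 12.5 (PDF pp. 191–192)] -/
theorem _root_.Literature.AlgebraicGeometry.Motives.AbelianVariety.faltingsTateMap_injective_end_of_degree
    (X : AbelianVariety K) (hiso : ∀ φ : X ⟶ X, φ ≠ 0 → IsIsogeny φ)
    (hdeg : ∀ (r : ℕ) (e : Fin r → (X ⟶ X)), ∃ F : MvPolynomial (Fin r) ℚ,
      (∀ (t : ℚ) (q : Fin r → ℚ), eval (t • q) F = t ^ (2 * X.dim) * eval q F) ∧
      ∀ n : Fin r → ℤ,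
        ((if IsIsogeny (∑ i, n i • e i) then (Hom.kerRank (∑ i, n i • e i) : ℤ) else 0 : ℤ) : ℚ) =
          eval (fun i => (n i : ℚ)) F) :
    faltingsTateMap_injective X X := by
  refine faltingsTateMap_injective_of_exists_fg_saturation X X ?_
  rcases Nat.eq_zero_or_pos X.dim with h0 | hpos
  · exact exists_fg_saturation_of_forall_eq_zero (hom_eq_zero_of_dim_eq_zero (Or.inl h0))
  · exact exists_fg_saturation_end_of_degree X hiso (not_isIsogeny_zero_of_dim_pos hpos) hdeg

open Classical in
/-- **The injectivity assertion of Mumford §19 Thm. 3 from its geometric inputs**: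
`faltingsTateMap_injective A B` follows from torsion-freeness of all `Hom(X, Y)` (§19 Thm. 3, first
step), "non-zero homomorphisms between simple abelian varieties are isogenies" (§19 Cor. 2 of
Thm. 1), the degree theorem for simple abelian varieties of positive dimension (§19 Thm. 2) and
Poincaré's complete reducibility theorem in split form (§19 Thm. 1 with Cor. 1 and the Remark
p. 169) — Step I being `exists_fg_saturation_hom_of_poincare` (`AVIsogenyTateHomPoincareProofs`) —
with no appeal to the torsion counts of `A`, `B`. [cite: MumfordAV1970, §19 Thm. 3] -/
theorem _root_.Literature.AlgebraicGeometry.Motives.AbelianVariety.faltingsTateMap_injective_of_poincare_of_degree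
    (htf : ∀ (X Y : AbelianVariety K) (n : ℤ) (f : X ⟶ Y), n ≠ 0 → n • f = 0 → f = 0)
    (hsimple : ∀ (X Y : AbelianVariety K), IsSimple X → IsSimple Y →
      ∀ f : X ⟶ Y, f ≠ 0 → IsIsogeny f)
    (hdeg : ∀ X : AbelianVariety K, IsSimple X → 0 < X.dim →
      ∀ (r : ℕ) (e : Fin r → (X ⟶ X)), ∃ F : MvPolynomial (Fin r) ℚ,
        (∀ (t : ℚ) (q : Fin r → ℚ), eval (t • q) F = t ^ (2 * X.dim) * eval q F) ∧
        ∀ n : Fin r → ℤ,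
          ((if IsIsogeny (∑ i, n i • e i) then (Hom.kerRank (∑ i, n i • e i) : ℤ) else 0 : ℤ) : ℚ) =
            eval (fun i => (n i : ℚ)) F)
    (hP : ∀ X : AbelianVariety K, ¬ IsSimple X → ∃ X₁ X₂ : AbelianVariety K,
      X₁.dim < X.dim ∧ X₂.dim < X.dim ∧ (∃ σ : X₁ ⊞ X₂ ⟶ X, IsIsogeny σ) ∧
        ∃ τ : X ⟶ X₁ ⊞ X₂, IsIsogeny τ)
    (A B : AbelianVariety K) : faltingsTateMap_injective A B :=
  faltingsTateMap_injective_of_exists_fg_saturation A B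
    (exists_fg_saturation_hom_of_poincare htf hsimple hdeg hP A B)

open Classical in
/-- **The same in characteristic zero**, where every `Hom(X, Y)` is torsion-free unconditionally
(`eq_zero_of_zsmul_eq_zero_of_cast_ne_zero`, `AVIsogenyTateFreeHomProofs`): `faltingsTateMap_injective A B`
from simplicity ⇒ isogeny, the degree theorem and Poincaré reducibility. [cite: MumfordAV1970, §19 Thm. 3] -/
theorem _root_.Literature.AlgebraicGeometry.Motives.AbelianVariety.faltingsTateMap_injective_of_poincare_of_degree_of_charZero
    [CharZero K]
    (hsimple : ∀ (X Y : AbelianVariety K), IsSimple X → IsSimple Y →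
      ∀ f : X ⟶ Y, f ≠ 0 → IsIsogeny f)
    (hdeg : ∀ X : AbelianVariety K, IsSimple X → 0 < X.dim →
      ∀ (r : ℕ) (e : Fin r → (X ⟶ X)), ∃ F : MvPolynomial (Fin r) ℚ,
        (∀ (t : ℚ) (q : Fin r → ℚ), eval (t • q) F = t ^ (2 * X.dim) * eval q F) ∧
        ∀ n : Fin r → ℤ,
          ((if IsIsogeny (∑ i, n i • e i) then (Hom.kerRank (∑ i, n i • e i) : ℤ) else 0 : ℤ) : ℚ) =
            eval (fun i => (n i : ℚ)) F)
    (hP : ∀ X : AbelianVariety K, ¬ IsSimple X → ∃ X₁ X₂ : AbelianVariety K,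
      X₁.dim < X.dim ∧ X₂.dim < X.dim ∧ (∃ σ : X₁ ⊞ X₂ ⟶ X, IsIsogeny σ) ∧
        ∃ τ : X ⟶ X₁ ⊞ X₂, IsIsogeny τ)
    (A B : AbelianVariety K) : faltingsTateMap_injective A B :=
  faltingsTateMap_injective_of_poincare_of_degree
    (fun _ _ _ _ hn h => eq_zero_of_zsmul_eq_zero_of_cast_ne_zero (Int.cast_ne_zero.2 hn) h)
    hsimple hdeg hP A B

open Classical in
/-- **The same in any characteristic, with torsion-freeness from the named fact
`isIsogeny_zsmul_id`** (`[n]_X` is an isogeny for `n ≠ 0`, Mumford §6 App. 2;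
`eq_zero_of_zsmul_eq_zero_of_isIsogeny`, `AVIsogenyTateFreeHomProofs`). [cite: MumfordAV1970, §19 Thm. 3] -/
theorem _root_.Literature.AlgebraicGeometry.Motives.AbelianVariety.faltingsTateMap_injective_of_poincare_of_degree_of_isIsogeny_zsmul_id
    (h₀ : ∀ X : AbelianVariety K, isIsogeny_zsmul_id X)
    (hsimple : ∀ (X Y : AbelianVariety K), IsSimple X → IsSimple Y →
      ∀ f : X ⟶ Y, f ≠ 0 → IsIsogeny f)
    (hdeg : ∀ X : AbelianVariety K, IsSimple X → 0 < X.dim →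
      ∀ (r : ℕ) (e : Fin r → (X ⟶ X)), ∃ F : MvPolynomial (Fin r) ℚ,
        (∀ (t : ℚ) (q : Fin r → ℚ), eval (t • q) F = t ^ (2 * X.dim) * eval q F) ∧
        ∀ n : Fin r → ℤ,
          ((if IsIsogeny (∑ i, n i • e i) then (Hom.kerRank (∑ i, n i • e i) : ℤ) else 0 : ℤ) : ℚ) =
            eval (fun i => (n i : ℚ)) F)
    (hP : ∀ X : AbelianVariety K, ¬ IsSimple X → ∃ X₁ X₂ : AbelianVariety K,
      X₁.dim < X.dim ∧ X₂.dim < X.dim ∧ (∃ σ : X₁ ⊞ X₂ ⟶ X, IsIsogeny σ) ∧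
        ∃ τ : X ⟶ X₁ ⊞ X₂, IsIsogeny τ)
    (A B : AbelianVariety K) : faltingsTateMap_injective A B :=
  faltingsTateMap_injective_of_poincare_of_degree
    (fun X _ _ _ hn h => eq_zero_of_zsmul_eq_zero_of_isIsogeny (h₀ X _ hn) h)
    hsimple hdeg hP A B

end AbelianVariety

end Literature.NumberTheory.DiophantineGeometry
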